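/-
Copyright (c) 2026 the pub-hodgecm-mathlib formalisation cell (harness21).  Prover seat hodgecm-mathlib-K2E3-p21 (g8), Track B «K2-LIT» ∕ h413,
line `K2_E3_EllipticInputs`, unit U12 «Characters», PART «RANK», leaf (qs2-ps) `sig_K2E3CharLocIntNearPrincipalSeriesQuasiSplitTwo`, road «van Dijk₂».
(ASM₂) FILE B2 — THE PAYER: the character of the principal series `i_G(χ)` of `G₂ = U(Φ₂)(L⁺_v)` (`v` non-split) is a locally integrable function, at representation
level (ASM₂-rep) and in the (qs2-ps) class-level shape, TOKEN FOR TOKEN.  2026-09-04.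
-/
import Summits.HodgeConjecture.HodgeConjecture.Theorems.K2E3QuasiSplitTwoWeightedClassFun     -- ★ (this seat) B1: `exists_weightedClassFun₂`, `measurePreserving_reflect₂`, `measurableEmbedding_reflect₂`; brings A1∕A2, ★ WeylDensity∕Kit∕Radial, ★ HCD₂, ★ CLS₂, ★ D115
import Summits.HodgeConjecture.HodgeConjecture.Theorems.K2E3QuasiSplitTwoVanDijk               -- ★ p860845 (K2E3-p11 g7) D116 (VDW₂): `smoothTrace_eq_inv_mul_integral_vanDijkWeight₂`
import Summits.HodgeConjecture.HodgeConjecture.Theorems.K2E3PrincipalSeriesCharPrelims         -- ★ (K2E3-p11 g3) generic `classOrbitalIntegral_congr_class` (orbital integrals are local on the class)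
import Literature.NumberTheory.Automorphic.LocalUnitaryGroupUnimodularIsotropic                 -- ★ `isMulRightInvariant_cmDatum_local_antidiagOne` (every Haar measure on `U(Φ_N)(L⁺_v)` is right invariant)
import Literature.NumberTheory.Automorphic.CMPrincipalSeriesOpenCellSection                     -- ★ `exists_coe_eq_antidiagonal` (the Weyl element `w₀` with matrix `Φ_N`)
import HarnessLib

/-!
# K2_E3 road (h413 = stmt-HodgeConjecture-24833), PART «RANK», leaf (qs2-ps) «van Dijk₂» — (ASM₂) FILE B2, THE PAYER:
# THE CHARACTER OF THE PRINCIPAL SERIES `i_G(χ)` OF `G₂ = U(Φ₂)(L⁺_v) = U(1,1)(L⁺_v)` (`v` NON-SPLIT) IS A LOCALLY INTEGRABLE FUNCTION `Θ_χ`, AND `Tr i_G(χ)(φ) = ∫ φ Θ_χ`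
# FOR EVERY `φ ∈ C_c^∞(G₂)` — van Dijk's theorem (Rogawski 1990 (4.9.4) p. 56, §12.5 p. 182; van Dijk 1972; Harish-Chandra 1970 Thm. 15 ∕ 1999 Thm. 16.1 for these representations)

Cell `pub/hodgecm-mathlib` (D-0151), Track B (21-frontier RULING «PUSH BOTH» 2026-09-03), `--supports stmt-HodgeConjecture-24833 --as helper`; THEOREMS ONLY — no `def`, no
instance, no notation, no named fact, no `sorry`; ★-only imports.  Seat K2E3-p21 (g8), (ASM₂)+head of (qs2-ps) BY BOOK (dealer K2E3-plan (g4) 2026-09-04T13:33:49Z; (ASM₂-rep)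
routing 13:54:57Z).  The N = 2 twin, token for token, of ★ `K2E3CharLocIntPrincipalSeriesThree` §4–§5 (K2E3-p11 (g3), the (11-PS) road at N = 3), assembled over the four ★ bricks
of the cut (VDW₂) ★ p860845 `K2E3QuasiSplitTwoVanDijk` (K2E3-p11), (HCD₂) ★ p860826 `K2E3U11WeylDiscrLocInt` (K2E3-p27), (WEYL₂) ★ p860713∕p860822∕p860877 `K2E3QuasiSplitTwoWeyl{Radial,Kit,Density}`
(K2E3-p14), (CLS₂-fun) ★ p860719 `K2E3HyperbolicClassFunOfTorusTwo` (K2E3-p25), on ★ D115 `K2E3QuasiSplitTwoTorusDefs` (K2E3-p26), with this seat's ★ A1∕A2∕B1 (VDW-CORE₂, junction, weighted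
class functions, reflection).

THE MATHEMATICS.  [Rogawski1990, §4.9 (4.9.4) p. 56, §12.5 p. 182; vanDijk1972, Thm. p. 237]: the character of `i_G(χ)` (`χ` a continuous character of the diagonal torus `T₂ ≅ L_wˣ`)
is the class function `Θ_χ(x t x⁻¹) = (χ(t) + χ(ʷt)) ∕ D_G(t)` on the regular hyperbolic set `Ω₂ = ⋃_x x T₂^{reg} x⁻¹` and `0` off `Ω₂`; it is locally integrable on `G₂` because
`D_G⁻¹ = |D_G|^{−1∕2}` is (HCD₂), and it represents the trace on ALL of `C_c^∞(G₂)`.  With `Θ_χ := (c₀∕c_T)·dg₂⁻¹·N_ψ`, `ψ = χ + χ∘ʷ` (★ B1), `c₀ = μM(ι₂⁻¹ T₂ᶜ)`, `c_T = (ι₂_*μM)(T₂ ∩ K_v)`: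
* §1 **`exists_locallyIntegrable_smoothTrace_cmPrincipalSeries_two_eq`** — `∃ Θ ∈ L¹_loc(ν), ∀ φ ∈ C_c^∞(G₂), Tr i_G(χ)(φ) = ∫ φ·Θ dν` (every continuous `χ`, every Haar `ν`): the
  (VDW₂) workhorse in torus form pulled back to `E_vˣ` along `ι₂` and `W`-symmetrised by the `μM`-preserving reflection `ω` (★ B1), the density WIF (WEYL₂) for `𝟙_{Ω₂}·φ` against the
  weighted class functions of `ψ` and of `‖χ‖ + ‖χ∘ʷ‖` (domination), the locality of orbital integrals on the class, and the pointwise identity `dg₂² · (Re Δ₂)⁻¹ = Δ₂` on `T₂^{reg}`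
  (★ A2 junction `dg₂ = Re Δ₂`, ★ A1 `Δ₂ = Re Δ₂`);
* §2 **(ASM₂-rep) `charLocIntNear_cmPrincipalSeries_two`** — the REPRESENTATION-LEVEL head the dealer asked for (13:54:57Z): for every `s : G₂` an open `U ∋ s` and `Θ ∈ L¹(U)` with
  `Tr i_G(χ)(f) = ∫ f·Θ` for every Schwartz–Bruhat `f` supported in `U` — the `hPS` binder of ★ p860893 `K2E3CharLocIntDifferenceOfRepresentedTwo` (K2E3-p23, (res-St)₂) TOKEN FOR TOKEN;
* §3 **(qs2-ps) `charLocIntNearPrincipalSeries_quasiSplitTwo`** — PART «RANK» ED. 2 :59–76 VERBATIM, for every class `c = ⟦r⟧` with `r ≅ i_G(χ)`: equivalent representations have the same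
  character (★ `Representation.smoothTrace_eq_of_equiv`, ★ `IrrClass.smoothTrace_mk`).

HONEST LABEL: HC_CM is proved only modulo the 7 printed citations (2 remaining named inputs: hLiu418 = stmt-HodgeConjecture-24832, h413 = stmt-HodgeConjecture-24833) until rung 0
closes; this file pays the RANK leaf (qs2-ps) once tied by the dealer ((11-2qs-Id′) stays REL over {(qs2-sc), (qs2-res)}); count-neutral until then.

## References
* [Rogawski1990] J. D. Rogawski, *Automorphic Representations of Unitary Groups in Three Variables*, Ann. of Math. Stud. 123 (1990), §4.9 Lemma 4.9.2, (4.9.4) p. 56; §12.5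
  p. 182 (Weyl integration formula, `D_G`); §12.2 p. 173; §12.1 p. 171; §1.6 p. 6 («`χ_π(f) = ∫ f(g) χ_π(g) dg`»).
* [vanDijk1972] G. van Dijk, *Computation of certain induced characters of 𝔭-adic groups*, Math. Ann. 199 (1972), §2, Thm. p. 237.
* [HarishChandra1970] Harish-Chandra (notes by G. van Dijk), *Harmonic Analysis on Reductive p-adic Groups*, LNM 162 (1970), Part VII §1 Thm. 15 (`|D|^{−1∕2} ∈ L¹_loc`), Lemmas 22, 42;
  Part V §3 Thm. 12.
* [HarishChandra1999] Harish-Chandra (notes by S. DeBacker, P. J. Sally), *Admissible Invariant Distributions on Reductive p-adic Groups*, ULS 16 (1999), Thm. 16.1 p. 77.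
-/

set_option autoImplicit false
-- the mandated namespace has the single-problem summit's repeated segment (`HodgeConjecture.HodgeConjecture`)
set_option linter.dupNamespace false

noncomputable section

open MeasureTheory Measure Set Filter Topology Function NumberField IsDedekindDomain Matrix
open Literature.MeasureTheory.Group
open Literature.NumberTheory.Automorphic Literature.NumberTheory.Automorphic.UnitaryGroup Literature.NumberTheory.Rogawski1990
open Literature.NumberTheory.GaloisRepresentations Literature.NumberTheory.GaloisRepresentations.IsNonarchimedeanLocalField
open Summit.HodgeConjecture.HodgeConjecture.Cruxes.H413
open Summit.HodgeConjecture.HodgeConjecture.Cruxes.H413.K2E3QuasiSplitTwoTorusDefs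
open Summit.HodgeConjecture.HodgeConjecture.Cruxes.H413.K2E3QuasiSplitTwoVanDijkCore
open Summit.HodgeConjecture.HodgeConjecture.Cruxes.H413.K2E3QuasiSplitTwoWeylDiscrJunction
open Summit.HodgeConjecture.HodgeConjecture.Cruxes.H413.K2E3QuasiSplitTwoWeightedClassFun
open Summit.HodgeConjecture.HodgeConjecture.Cruxes.H413.K2E3QuasiSplitTwoWeylKit
open scoped ENNReal NNReal MatrixGroups ComplexConjugate

namespace Summit.HodgeConjecture.HodgeConjecture.Cruxes.H413.K2E3CharLocIntNearPrincipalSeriesQuasiSplitTwo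

variable (L : Type) [Field L] [NumberField L] [IsCMField L] (v : HeightOneSpectrum (𝓞 ↥(maximalRealSubfield L)))

/-! ## §1 The character of `i_G(χ)` is a locally integrable function representing the trace on all of `C_c^∞(G₂)` -/

set_option maxHeartbeats 3200000 in
set_option synthInstance.maxHeartbeats 400000 in
-- a long assembly over the ★ bricks (the van Dijk workhorse, the density WIF, HC-D); the budget is for the many `integral_congr_ae` steps (as in the ★ N = 3 original)
/-- **THE CHARACTER OF THE PRINCIPAL SERIES OF `U(1,1)(L⁺_v)` IS A LOCALLY INTEGRABLE FUNCTION.**  `G₂ = U(Φ₂)(L⁺_v)`, `v` NON-SPLIT, `ν` any Haar measure, `χ : T₂ →* ℂˣ` continuous.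
There is `Θ : G₂ → ℂ`, LOCALLY INTEGRABLE, with **`Tr i_G(χ)(φ) = ∫_{G₂} φ·Θ dν` for EVERY locally constant compactly supported `φ`** — van Dijk's theorem `Θ = (χ + χ∘ʷ)∕D_G` on the
regular hyperbolic set, `0` off it [Rogawski1990 (4.9.4), §12.5], i.e. Harish-Chandra's Theorem 16.1 for the representations `i_G(χ)` (irreducible or not).
Witness: `Θ = (c₀∕c_T)·dg₂⁻¹·N_{χ+χ∘ʷ}` (★ B1).  PROOF: ★ (VDW₂) (torus form, pulled back to `E_vˣ`, `W`-symmetrised by the `μM`-preserving reflection — the symmetrisation needs the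
integrability of the torus-side integrand, dominated through ★ (WEYL₂)'s integrability by the weighted class function of `‖χ‖ + ‖χ∘ʷ‖`), ★ (WEYL₂) (density WIF for `𝟙_{Ω₂}·φ`; the orbital
integrals of `𝟙_{Ω₂}·φ` and `φ` agree at regular torus classes), and the pointwise identity `dg₂²·(Re Δ₂)⁻¹ = Δ₂` on `T₂^{reg}` (★ A2, ★ A1).  The N = 2 twin of ★
`K2E3CharLocIntPrincipalSeriesThree.exists_locallyIntegrable_smoothTrace_cmPrincipalSeries_eq`.
[cite: Rogawski1990, §4.9 (4.9.4) p. 56; §12.5 p. 182; §1.6 p. 6] [cite: vanDijk1972, Thm. p. 237] [cite: HarishChandra1970, Part VII §1 Thm. 15; Lemma 42]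
[cite: HarishChandra1999, Thm. 16.1 p. 77] -/
theorem exists_locallyIntegrable_smoothTrace_cmPrincipalSeries_two_eq
    (hns : ∀ w : PlacesOver L v, IsCMField.complexConj L • w.1 = w.1)
    [MeasurableSpace ↥(unitaryGroupOfForm (conjLocal L (IsCMField.complexConj L) v) (cmLocalForm L 2 v))] [BorelSpace ↥(unitaryGroupOfForm (conjLocal L (IsCMField.complexConj L) v) (cmLocalForm L 2 v))]
    (νQv : Measure ↥(unitaryGroupOfForm (conjLocal L (IsCMField.complexConj L) v) (cmLocalForm L 2 v))) [νQv.IsHaarMeasure]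
    (χ : ↥(cmBorelTriple L 2 v).M →* ℂˣ) (hχ : Continuous fun t => ((χ t : ℂˣ) : ℂ)) :
    ∃ Θ : ↥(unitaryGroupOfForm (conjLocal L (IsCMField.complexConj L) v) (cmLocalForm L 2 v)) → ℂ, LocallyIntegrable Θ νQv ∧
      ∀ φ : ↥(unitaryGroupOfForm (conjLocal L (IsCMField.complexConj L) v) (cmLocalForm L 2 v)) → ℂ, IsLocallyConstant φ → HasCompactSupport φ →
        Representation.smoothTrace (G := ↥(unitaryGroupOfForm (conjLocal L (IsCMField.complexConj L) v) (cmLocalForm L 2 v))) (UnitaryGroup.cmPrincipalSeries L 2 v χ) νQv φ =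
          ∫ g, φ g * Θ g ∂νQv := by
  classical
  -- §a instances on the carrier, its `cmDatum` spelling (the home of ★ (VDW₂) and of ★ unimodularity), the quotients, the parameter torus `E_vˣ`
  haveI : LocallyCompactSpace ↥(unitaryGroupOfForm (conjLocal L (IsCMField.complexConj L) v) (cmLocalForm L 2 v)) := locallyCompactSpace_local (IsCMField.complexConj L) 2 _ v
  haveI : SecondCountableTopology ↥(unitaryGroupOfForm (conjLocal L (IsCMField.complexConj L) v) (cmLocalForm L 2 v)) := secondCountableTopology_local (IsCMField.complexConj L) 2 _ v
  haveI : T2Space ↥(unitaryGroupOfForm (conjLocal L (IsCMField.complexConj L) v) (cmLocalForm L 2 v)) := t2Space_cmDatum_local 2 L (Matrix.of fun i j : Fin 2 => if i.val + j.val + 1 = 2 then (1 : L) else 0) v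
  letI hq : ∀ γ : ↥(unitaryGroupOfForm (conjLocal L (IsCMField.complexConj L) v) (cmLocalForm L 2 v)),
      MeasurableSpace (↥(unitaryGroupOfForm (conjLocal L (IsCMField.complexConj L) v) (cmLocalForm L 2 v)) ⧸ Subgroup.centralizer ({γ} : Set ↥(unitaryGroupOfForm (conjLocal L (IsCMField.complexConj L) v) (cmLocalForm L 2 v)))) :=
    fun γ => borel _
  haveI hqb : ∀ γ : ↥(unitaryGroupOfForm (conjLocal L (IsCMField.complexConj L) v) (cmLocalForm L 2 v)),
      BorelSpace (↥(unitaryGroupOfForm (conjLocal L (IsCMField.complexConj L) v) (cmLocalForm L 2 v)) ⧸ Subgroup.centralizer ({γ} : Set ↥(unitaryGroupOfForm (conjLocal L (IsCMField.complexConj L) v) (cmLocalForm L 2 v)))) :=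
    fun γ => ⟨rfl⟩
  letI hmsC : MeasurableSpace ((UnitaryGroup.cmDatum L 2 (Matrix.of fun i j : Fin 2 => if i.val + j.val + 1 = 2 then (1 : L) else 0)).Local v) :=
    ‹MeasurableSpace ↥(unitaryGroupOfForm (conjLocal L (IsCMField.complexConj L) v) (cmLocalForm L 2 v))›
  haveI hbC : BorelSpace ((UnitaryGroup.cmDatum L 2 (Matrix.of fun i j : Fin 2 => if i.val + j.val + 1 = 2 then (1 : L) else 0)).Local v) :=
    ⟨BorelSpace.measurable_eq (α := ↥(unitaryGroupOfForm (conjLocal L (IsCMField.complexConj L) v) (cmLocalForm L 2 v)))⟩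
  letI hqC : ∀ γ : (UnitaryGroup.cmDatum L 2 (Matrix.of fun i j : Fin 2 => if i.val + j.val + 1 = 2 then (1 : L) else 0)).Local v,
      MeasurableSpace (((UnitaryGroup.cmDatum L 2 (Matrix.of fun i j : Fin 2 => if i.val + j.val + 1 = 2 then (1 : L) else 0)).Local v) ⧸
        Subgroup.centralizer ({γ} : Set ((UnitaryGroup.cmDatum L 2 (Matrix.of fun i j : Fin 2 => if i.val + j.val + 1 = 2 then (1 : L) else 0)).Local v))) := hq
  haveI hqbC : ∀ γ : (UnitaryGroup.cmDatum L 2 (Matrix.of fun i j : Fin 2 => if i.val + j.val + 1 = 2 then (1 : L) else 0)).Local v,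
      BorelSpace (((UnitaryGroup.cmDatum L 2 (Matrix.of fun i j : Fin 2 => if i.val + j.val + 1 = 2 then (1 : L) else 0)).Local v) ⧸
        Subgroup.centralizer ({γ} : Set ((UnitaryGroup.cmDatum L 2 (Matrix.of fun i j : Fin 2 => if i.val + j.val + 1 = 2 then (1 : L) else 0)).Local v))) := hqb
  haveI hHC : Measure.IsHaarMeasure (G := (UnitaryGroup.cmDatum L 2 (Matrix.of fun i j : Fin 2 => if i.val + j.val + 1 = 2 then (1 : L) else 0)).Local v) νQv := ‹νQv.IsHaarMeasure›
  have hνrC : Measure.IsMulRightInvariant (G := (UnitaryGroup.cmDatum L 2 (Matrix.of fun i j : Fin 2 => if i.val + j.val + 1 = 2 then (1 : L) else 0)).Local v) νQv :=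
    isMulRightInvariant_cmDatum_local_antidiagOne L 2 v νQv
  haveI := hνrC
  haveI hνr : νQv.IsMulRightInvariant := hνrC
  letI : MeasurableSpace (LocalRing L v)ˣ := borel _
  haveI : BorelSpace (LocalRing L v)ˣ := ⟨rfl⟩
  haveI := locallyCompactSpace_units₂ L v
  haveI := F0P3cStCharTSTorusRay.secondCountableTopology_units_localRing L v
  obtain ⟨μM, hμM⟩ : ∃ μM : Measure (LocalRing L v)ˣ, μM.IsHaarMeasure := ⟨Measure.haar, inferInstance⟩
  haveI hμT : (μM.map (torusChart₂ L v)).IsHaarMeasure := isHaarMeasure_map_torusChart₂ L v μM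
  -- the two constants of the torus measure `ι₂_* μM`
  obtain ⟨hcoreC, hcoreO⟩ := isCompact_isOpen_compactCore_cmTorus₂ L v hns
  obtain ⟨c₀, hc₀⟩ : ∃ c : ℝ≥0∞, c = μM ((torusChart₂ L v) ⁻¹' compactCore ↥(cmBorelTriple L 2 v).M) := ⟨_, rfl⟩
  have hmap : (μM.map (torusChart₂ L v)) (compactCore ↥(cmBorelTriple L 2 v).M) = μM ((torusChart₂ L v) ⁻¹' compactCore ↥(cmBorelTriple L 2 v).M) :=
    map_torusChart₂_apply_compactCore L v hns μM
  have hc0 : c₀ ≠ 0 := by rw [hc₀, ← hmap]; exact (hcoreO.measure_pos _ ⟨1, one_mem_compactCore⟩).ne'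
  have hctop : c₀ ≠ ∞ := by rw [hc₀, ← hmap]; exact hcoreC.measure_lt_top.ne
  have hc₀r : c₀.toReal ≠ 0 := ENNReal.toReal_ne_zero.2 ⟨hc0, hctop⟩
  obtain ⟨cT, hcT⟩ : ∃ c : ℝ, c = (μM.map (torusChart₂ L v)).real {t : ↥(cmBorelTriple L 2 v).M | (t : ↥(unitaryGroupOfForm (conjLocal L (IsCMField.complexConj L) v) (cmLocalForm L 2 v))) ∈ cmLocalIntegralLevel L 2 (Matrix.of fun i j : Fin 2 => if i.val + j.val + 1 = 2 then (1 : L) else 0) v} := ⟨_, rfl⟩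
  -- canonical orbital measures (★ canonical Haar measures on the regular centralisers, any `N`); the Weyl element; the reflected torus point
  obtain ⟨mQv, hcanQ⟩ : ∃ mQv : OrbitalMeasureFamily ↥(unitaryGroupOfForm (conjLocal L (IsCMField.complexConj L) v) (cmLocalForm L 2 v)),
      mQv.IsCanonical (fun γ => IsRegularElt (γ.val : GL (Fin 2) (UnitaryGroup.LocalRing L v))) νQv := by
    letI : MeasurableSpace ↥(«local» L (IsCMField.complexConj L) 2 (Matrix.of fun i j : Fin 2 => if i.val + j.val + 1 = 2 then (1 : L) else 0) v) :=
      ‹MeasurableSpace ↥(unitaryGroupOfForm (conjLocal L (IsCMField.complexConj L) v) (cmLocalForm L 2 v))›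
    haveI : BorelSpace ↥(«local» L (IsCMField.complexConj L) 2 (Matrix.of fun i j : Fin 2 => if i.val + j.val + 1 = 2 then (1 : L) else 0) v) :=
      ‹BorelSpace ↥(unitaryGroupOfForm (conjLocal L (IsCMField.complexConj L) v) (cmLocalForm L 2 v))›
    exact OrbitalMeasureFamily.exists_isCanonical _ νQv
      (forall_isRegularElt_exists_isHaarMeasure_compactCore_centralizer_local_eq_one (IsCMField.complexConj L) 2
        (Matrix.of fun i j : Fin 2 => if i.val + j.val + 1 = 2 then (1 : L) else 0) (IsCMField.complexConj_ne_one L)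
        (antidiagOne_map_transpose (IsCMField.complexConj L) 2) (isUnit_antidiagOne_det L 2))
  obtain ⟨w₀, hw₀'⟩ := exists_coe_eq_antidiagonal L (IsCMField.complexConj L) 2 v (cmLocalForm_eq_over L 2 v)
  have hw₀ : Units.val (w₀ : GL (Fin 2) (LocalRing L v)) = cmLocalForm L 2 v := by rw [hw₀', cmLocalForm_eq_over]
  have hwc : Continuous fun t : ↥(cmBorelTriple L 2 v).M => (⟨w₀ * ((t) : ↥(unitaryGroupOfForm (conjLocal L (IsCMField.complexConj L) v) (cmLocalForm L 2 v))) * w₀⁻¹, UnitaryGroup.weylConj_mem_cmTorus_two L v w₀ hw₀ (t)⟩ : ↥(cmBorelTriple L 2 v).M) :=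
    ((continuous_const.mul continuous_subtype_val).mul continuous_const).subtype_mk _
  have hww : ∀ t : ↥(cmBorelTriple L 2 v).M, (⟨w₀ * (((⟨w₀ * ((t) : ↥(unitaryGroupOfForm (conjLocal L (IsCMField.complexConj L) v) (cmLocalForm L 2 v))) * w₀⁻¹, UnitaryGroup.weylConj_mem_cmTorus_two L v w₀ hw₀ (t)⟩ : ↥(cmBorelTriple L 2 v).M)) : ↥(unitaryGroupOfForm (conjLocal L (IsCMField.complexConj L) v) (cmLocalForm L 2 v))) * w₀⁻¹, UnitaryGroup.weylConj_mem_cmTorus_two L v w₀ hw₀ ((⟨w₀ * ((t) : ↥(unitaryGroupOfForm (conjLocal L (IsCMField.complexConj L) v) (cmLocalForm L 2 v))) * w₀⁻¹, UnitaryGroup.weylConj_mem_cmTorus_two L v w₀ hw₀ (t)⟩ : ↥(cmBorelTriple L 2 v).M))⟩ : ↥(cmBorelTriple L 2 v).M) = t :=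
    fun t => weylConj_weylConj_eq L v w₀ hw₀ t
  -- §b the torus functions `ψ = χ + χ ∘ ʷ`, `ψ₂ = ‖χ‖ + ‖χ ∘ ʷ‖` and their weighted class functions (★ B1)
  obtain ⟨ψ, hψ⟩ : ∃ ψ : ↥(cmBorelTriple L 2 v).M → ℂ, ∀ t, ψ t = ((χ t : ℂˣ) : ℂ) + ((χ (⟨w₀ * ((t) : ↥(unitaryGroupOfForm (conjLocal L (IsCMField.complexConj L) v) (cmLocalForm L 2 v))) * w₀⁻¹, UnitaryGroup.weylConj_mem_cmTorus_two L v w₀ hw₀ (t)⟩ : ↥(cmBorelTriple L 2 v).M) : ℂˣ) : ℂ) := ⟨fun t => _, fun t => rfl⟩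
  obtain ⟨ψ₂, hψ₂⟩ : ∃ ψ₂ : ↥(cmBorelTriple L 2 v).M → ℂ, ∀ t, ψ₂ t = (((‖((χ t : ℂˣ) : ℂ)‖ + ‖((χ (⟨w₀ * ((t) : ↥(unitaryGroupOfForm (conjLocal L (IsCMField.complexConj L) v) (cmLocalForm L 2 v))) * w₀⁻¹, UnitaryGroup.weylConj_mem_cmTorus_two L v w₀ hw₀ (t)⟩ : ↥(cmBorelTriple L 2 v).M) : ℂˣ) : ℂ)‖ : ℝ)) : ℂ) := ⟨fun t => _, fun t => rfl⟩
  have hψc : Continuous ψ := by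
    have : ψ = fun t => ((χ t : ℂˣ) : ℂ) + ((χ (⟨w₀ * ((t) : ↥(unitaryGroupOfForm (conjLocal L (IsCMField.complexConj L) v) (cmLocalForm L 2 v))) * w₀⁻¹, UnitaryGroup.weylConj_mem_cmTorus_two L v w₀ hw₀ (t)⟩ : ↥(cmBorelTriple L 2 v).M) : ℂˣ) : ℂ) := funext hψ
    rw [this]; exact hχ.add (hχ.comp hwc)
  have hψ₂c : Continuous ψ₂ := by
    have : ψ₂ = fun t => (((‖((χ t : ℂˣ) : ℂ)‖ + ‖((χ (⟨w₀ * ((t) : ↥(unitaryGroupOfForm (conjLocal L (IsCMField.complexConj L) v) (cmLocalForm L 2 v))) * w₀⁻¹, UnitaryGroup.weylConj_mem_cmTorus_two L v w₀ hw₀ (t)⟩ : ↥(cmBorelTriple L 2 v).M) : ℂˣ) : ℂ)‖ : ℝ)) : ℂ) := funext hψ₂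
    rw [this]; exact Complex.continuous_ofReal.comp ((continuous_norm.comp hχ).add (continuous_norm.comp (hχ.comp hwc)))
  have hψw : ∀ t : ↥(cmBorelTriple L 2 v).M, ψ (⟨w₀ * ((t) : ↥(unitaryGroupOfForm (conjLocal L (IsCMField.complexConj L) v) (cmLocalForm L 2 v))) * w₀⁻¹, UnitaryGroup.weylConj_mem_cmTorus_two L v w₀ hw₀ (t)⟩ : ↥(cmBorelTriple L 2 v).M) = ψ t := fun t => by rw [hψ, hψ, hww, add_comm]
  have hψ₂w : ∀ t : ↥(cmBorelTriple L 2 v).M, ψ₂ (⟨w₀ * ((t) : ↥(unitaryGroupOfForm (conjLocal L (IsCMField.complexConj L) v) (cmLocalForm L 2 v))) * w₀⁻¹, UnitaryGroup.weylConj_mem_cmTorus_two L v w₀ hw₀ (t)⟩ : ↥(cmBorelTriple L 2 v).M) = ψ₂ t := fun t => by rw [hψ₂, hψ₂, hww, add_comm]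
  obtain ⟨α, hαm, hαli, hαinv, hα0, hαT⟩ := exists_weightedClassFun₂ L v hns νQv w₀ hw₀ ψ hψc hψw
  obtain ⟨α₂, hα₂m, hα₂li, hα₂inv, -, hα₂T⟩ := exists_weightedClassFun₂ L v hns νQv w₀ hw₀ ψ₂ hψ₂c hψ₂w
  -- §c the witness `Θ = (c₀ ∕ c_T) · α`
  refine ⟨fun g => ((c₀.toReal * cT⁻¹ : ℝ) : ℂ) * α g, ?_, fun φ hφ hφc => ?_⟩
  · have h := hαli.smul ((c₀.toReal * cT⁻¹ : ℝ) : ℂ)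
    simpa only [Pi.smul_def, smul_eq_mul] using h
  -- §d the identity
  -- (1) ★ (VDW₂) in torus form for `μ_T = ι₂_* μM` (read on the carrier from its `cmDatum` spelling), pulled back to `E_vˣ`
  have h1 : Representation.smoothTrace (G := ↥(unitaryGroupOfForm (conjLocal L (IsCMField.complexConj L) v) (cmLocalForm L 2 v))) (UnitaryGroup.cmPrincipalSeries L 2 v χ) νQv φ =
      (((cT⁻¹ : ℝ)) : ℂ) * ∫ m : (LocalRing L v)ˣ, (((χ (torusChart₂ L v m)) : ℂˣ) : ℂ) * (vanDijkWeight₂ L v (torusChart₂ L v m) *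
        classOrbitalIntegral mQv φ (ConjClasses.mk (((torusChart₂ L v m) : ↥(cmBorelTriple L 2 v).M) : ↥(unitaryGroupOfForm (conjLocal L (IsCMField.complexConj L) v) (cmLocalForm L 2 v))))) ∂μM := by
    have h := K2E3QuasiSplitTwoVanDijk.smoothTrace_eq_inv_mul_integral_vanDijkWeight₂ L v hns νQv mQv hcanQ χ hχ φ hφ hφc (μM.map (torusChart₂ L v))
    rw [← hcT, integral_comp_torusChart₂] at h
    exact h
  -- (2) the reflection `ω` of `E_vˣ`: `Δ₂` and the orbital integrals are `ω`-invariant, so is the torus-side integral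
  have hG : ∀ m : (LocalRing L v)ˣ,
      vanDijkWeight₂ L v (torusChart₂ L v (Units.map ((conjLocal L (IsCMField.complexConj L) v : LocalRing L v →+* LocalRing L v) : LocalRing L v →* LocalRing L v) m)⁻¹) * classOrbitalIntegral mQv φ (ConjClasses.mk ((((torusChart₂ L v (Units.map ((conjLocal L (IsCMField.complexConj L) v : LocalRing L v →+* LocalRing L v) : LocalRing L v →* LocalRing L v) m)⁻¹)) : ↥(cmBorelTriple L 2 v).M) : ↥(unitaryGroupOfForm (conjLocal L (IsCMField.complexConj L) v) (cmLocalForm L 2 v)))) =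
        vanDijkWeight₂ L v (torusChart₂ L v m) * classOrbitalIntegral mQv φ (ConjClasses.mk ((((torusChart₂ L v m) : ↥(cmBorelTriple L 2 v).M) : ↥(unitaryGroupOfForm (conjLocal L (IsCMField.complexConj L) v) (cmLocalForm L 2 v))))) := by
    intro m
    rw [torusChart₂_reflect L v w₀ hw₀ m, vanDijkWeight₂_weylConj L v w₀ hw₀ (torusChart₂ L v m)]
    congr 2
    refine ConjClasses.mk_eq_mk_iff_isConj.2 (isConj_iff.2 ⟨(w₀⁻¹ : ↥(unitaryGroupOfForm (conjLocal L (IsCMField.complexConj L) v) (cmLocalForm L 2 v))), ?_⟩)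
    show w₀⁻¹ * (w₀ * ((torusChart₂ L v m : ↥(cmBorelTriple L 2 v).M) : ↥(unitaryGroupOfForm (conjLocal L (IsCMField.complexConj L) v) (cmLocalForm L 2 v))) * w₀⁻¹) * w₀⁻¹⁻¹ =
      (((torusChart₂ L v m) : ↥(cmBorelTriple L 2 v).M) : ↥(unitaryGroupOfForm (conjLocal L (IsCMField.complexConj L) v) (cmLocalForm L 2 v)))
    group
  have hχω : ∀ m : (LocalRing L v)ˣ, ((χ (⟨w₀ * ((torusChart₂ L v m) : ↥(unitaryGroupOfForm (conjLocal L (IsCMField.complexConj L) v) (cmLocalForm L 2 v))) * w₀⁻¹, UnitaryGroup.weylConj_mem_cmTorus_two L v w₀ hw₀ (torusChart₂ L v m)⟩ : ↥(cmBorelTriple L 2 v).M) : ℂˣ) : ℂ) = (((χ (torusChart₂ L v (Units.map ((conjLocal L (IsCMField.complexConj L) v : LocalRing L v →+* LocalRing L v) : LocalRing L v →* LocalRing L v) m)⁻¹)) : ℂˣ) : ℂ) := by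
    intro m; rw [torusChart₂_reflect L v w₀ hw₀ m]
  -- (3) the density WIF (★ WEYL₂) for `𝟙_{Ω₂} φ` against `α`, and the integrability of the density-side integrands against `α₂` and `1`
  have hΩm : MeasurableSet (hyperbolicSet₂ L v : Set ↥(unitaryGroupOfForm (conjLocal L (IsCMField.complexConj L) v) (cmLocalForm L 2 v))) := measurableSet_hyperbolicSet₂ L v hns
  obtain ⟨φ', hφ'⟩ : ∃ φ' : ↥(unitaryGroupOfForm (conjLocal L (IsCMField.complexConj L) v) (cmLocalForm L 2 v)) → ℂ, φ' = (hyperbolicSet₂ L v).indicator φ := ⟨_, rfl⟩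
  have hφ'm : Measurable φ' := by rw [hφ']; exact hφ.continuous.measurable.indicator hΩm
  have hφ'0 : ∀ x : ↥(unitaryGroupOfForm (conjLocal L (IsCMField.complexConj L) v) (cmLocalForm L 2 v)), x ∉ hyperbolicSet₂ L v → φ' x = 0 := fun x hx => by rw [hφ']; exact Set.indicator_of_notMem hx _
  have hφ'Ω : ∀ x : ↥(unitaryGroupOfForm (conjLocal L (IsCMField.complexConj L) v) (cmLocalForm L 2 v)), x ∈ hyperbolicSet₂ L v → φ' x = φ x := fun x hx => by rw [hφ']; exact Set.indicator_of_mem hx _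
  have hφα : Integrable (fun x => φ x * α x) νQv := by
    have h := hαli.integrable_smul_left_of_hasCompactSupport hφ.continuous hφc
    simpa only [smul_eq_mul] using h
  have hφα₂ : Integrable (fun x => φ x * α₂ x) νQv := by
    have h := hα₂li.integrable_smul_left_of_hasCompactSupport hφ.continuous hφc
    simpa only [smul_eq_mul] using h
  have hφ1 : Integrable (fun x => φ x * (1 : ℂ)) νQv := by
    simpa only [mul_one] using hφ.continuous.integrable_of_hasCompactSupport hφc
  have hint : ∀ β : ↥(unitaryGroupOfForm (conjLocal L (IsCMField.complexConj L) v) (cmLocalForm L 2 v)) → ℂ, Integrable (fun x => φ x * β x) νQv →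
      IntegrableOn (fun x => φ' x * β x) (hyperbolicSet₂ L v) νQv := fun β hβ =>
    hβ.integrableOn.congr_fun (fun x hx => by simp only [hφ'Ω x hx]) hΩm
  obtain ⟨hW, -⟩ := K2E3QuasiSplitTwoWeylDensity.density_wif_and_integrable₂ L v hns νQv hcanQ μM φ' α hφ'm hαinv (hint α hφα) hφ'0
  obtain ⟨-, hI₂⟩ := K2E3QuasiSplitTwoWeylDensity.density_wif_and_integrable₂ L v hns νQv hcanQ μM φ' α₂ hφ'm hα₂inv (hint α₂ hφα₂) hφ'0
  obtain ⟨-, hI₁⟩ := K2E3QuasiSplitTwoWeylDensity.density_wif_and_integrable₂ L v hns νQv hcanQ μM φ' (fun _ => (1 : ℂ)) hφ'm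
    (fun _ _ _ => rfl) (hint (fun _ => (1 : ℂ)) hφ1) hφ'0
  rw [← hc₀] at hW hI₂ hI₁
  -- (4) almost every parameter is regular: there `Re Δ₂ > 0`, `dg₂ = Re Δ₂`, and the two test functions have the same orbital integrals
  have hreg : ∀ᵐ m ∂μM, IsRegularElt (((((torusChart₂ L v m) : ↥(cmBorelTriple L 2 v).M) : ↥(unitaryGroupOfForm (conjLocal L (IsCMField.complexConj L) v) (cmLocalForm L 2 v)))) : GL (Fin 2) (LocalRing L v)) ∧ 0 < (vanDijkWeight₂ L v (torusChart₂ L v m)).re :=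
    ae_of_ae_map (p := fun t : ↥(cmBorelTriple L 2 v).M =>
      IsRegularElt (((t : ↥(unitaryGroupOfForm (conjLocal L (IsCMField.complexConj L) v) (cmLocalForm L 2 v)))) : GL (Fin 2) (LocalRing L v)) ∧
        0 < (vanDijkWeight₂ L v t).re) (continuous_torusChart₂ L v).measurable.aemeasurable (ae_isRegularElt_and_vanDijkWeight₂_re_pos L v (μM.map (torusChart₂ L v)))
  have hO' : ∀ m : (LocalRing L v)ˣ, IsRegularElt (((((torusChart₂ L v m) : ↥(cmBorelTriple L 2 v).M) : ↥(unitaryGroupOfForm (conjLocal L (IsCMField.complexConj L) v) (cmLocalForm L 2 v)))) : GL (Fin 2) (LocalRing L v)) →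
      classOrbitalIntegral mQv φ' (ConjClasses.mk ((((torusChart₂ L v m) : ↥(cmBorelTriple L 2 v).M) : ↥(unitaryGroupOfForm (conjLocal L (IsCMField.complexConj L) v) (cmLocalForm L 2 v))))) = classOrbitalIntegral mQv φ (ConjClasses.mk ((((torusChart₂ L v m) : ↥(cmBorelTriple L 2 v).M) : ↥(unitaryGroupOfForm (conjLocal L (IsCMField.complexConj L) v) (cmLocalForm L 2 v))))) := by
    intro m hm
    refine K2E3PrincipalSeriesCharPrelims.classOrbitalIntegral_congr_class mQv _ (fun y hy => hφ'Ω y ?_)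
    exact ⟨torusChart₂ L v m, hm, (ConjClasses.mk_eq_mk_iff_isConj.1 hy).symm⟩
  -- (5) pointwise bookkeeping at a regular parameter: the value of the density-side integrand and the norm domination
  have hc : 0 < c₀.toReal := ENNReal.toReal_pos hc0 hctop
  have hρval : ∀ m : (LocalRing L v)ˣ, IsRegularElt (((((torusChart₂ L v m) : ↥(cmBorelTriple L 2 v).M) : ↥(unitaryGroupOfForm (conjLocal L (IsCMField.complexConj L) v) (cmLocalForm L 2 v)))) : GL (Fin 2) (LocalRing L v)) → 0 < (vanDijkWeight₂ L v (torusChart₂ L v m)).re →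
      classOrbitalIntegral mQv φ' (ConjClasses.mk ((((torusChart₂ L v m) : ↥(cmBorelTriple L 2 v).M) : ↥(unitaryGroupOfForm (conjLocal L (IsCMField.complexConj L) v) (cmLocalForm L 2 v))))) * (((2 * c₀.toReal)⁻¹ * dgFormula₂ L v ((((torusChart₂ L v m) : ↥(cmBorelTriple L 2 v).M) : ↥(unitaryGroupOfForm (conjLocal L (IsCMField.complexConj L) v) (cmLocalForm L 2 v)))) ^ 2 : ℝ) : ℂ) * α ((((torusChart₂ L v m) : ↥(cmBorelTriple L 2 v).M) : ↥(unitaryGroupOfForm (conjLocal L (IsCMField.complexConj L) v) (cmLocalForm L 2 v)))) =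
        (((2 * c₀.toReal)⁻¹ : ℝ) : ℂ) * (ψ (torusChart₂ L v m) * (vanDijkWeight₂ L v (torusChart₂ L v m) * classOrbitalIntegral mQv φ (ConjClasses.mk ((((torusChart₂ L v m) : ↥(cmBorelTriple L 2 v).M) : ↥(unitaryGroupOfForm (conjLocal L (IsCMField.complexConj L) v) (cmLocalForm L 2 v))))))) := by
    intro m hmreg hpos
    have hΔ : vanDijkWeight₂ L v (torusChart₂ L v m) = (((vanDijkWeight₂ L v (torusChart₂ L v m)).re : ℝ) : ℂ) := (ofReal_vanDijkWeight₂_re L v _).symm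
    rw [hO' m hmreg, hαT _ hmreg, dgFormula₂_coe_torus_eq_vanDijkWeight₂_re L v (torusChart₂ L v m)]
    generalize hr : (vanDijkWeight₂ L v (torusChart₂ L v m)).re = r at hpos ⊢
    rw [show vanDijkWeight₂ L v (torusChart₂ L v m) = ((r : ℝ) : ℂ) by rw [hΔ, hr]]
    have hr0 : (r : ℂ) ≠ 0 := Complex.ofReal_ne_zero.2 hpos.ne'
    push_cast
    field_simp
  have hnormS : ∀ m : (LocalRing L v)ˣ, IsRegularElt (((((torusChart₂ L v m) : ↥(cmBorelTriple L 2 v).M) : ↥(unitaryGroupOfForm (conjLocal L (IsCMField.complexConj L) v) (cmLocalForm L 2 v)))) : GL (Fin 2) (LocalRing L v)) → 0 < (vanDijkWeight₂ L v (torusChart₂ L v m)).re →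
      ‖(((χ (torusChart₂ L v m)) : ℂˣ) : ℂ) * (vanDijkWeight₂ L v (torusChart₂ L v m) * classOrbitalIntegral mQv φ (ConjClasses.mk ((((torusChart₂ L v m) : ↥(cmBorelTriple L 2 v).M) : ↥(unitaryGroupOfForm (conjLocal L (IsCMField.complexConj L) v) (cmLocalForm L 2 v))))))‖ ≤
        2 * c₀.toReal * ‖classOrbitalIntegral mQv φ' (ConjClasses.mk ((((torusChart₂ L v m) : ↥(cmBorelTriple L 2 v).M) : ↥(unitaryGroupOfForm (conjLocal L (IsCMField.complexConj L) v) (cmLocalForm L 2 v))))) * (((2 * c₀.toReal)⁻¹ * dgFormula₂ L v ((((torusChart₂ L v m) : ↥(cmBorelTriple L 2 v).M) : ↥(unitaryGroupOfForm (conjLocal L (IsCMField.complexConj L) v) (cmLocalForm L 2 v)))) ^ 2 : ℝ) : ℂ) * α₂ ((((torusChart₂ L v m) : ↥(cmBorelTriple L 2 v).M) : ↥(unitaryGroupOfForm (conjLocal L (IsCMField.complexConj L) v) (cmLocalForm L 2 v))))‖ := by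
    intro m hmreg hpos
    have hΔ : vanDijkWeight₂ L v (torusChart₂ L v m) = (((vanDijkWeight₂ L v (torusChart₂ L v m)).re : ℝ) : ℂ) := (ofReal_vanDijkWeight₂_re L v _).symm
    rw [hO' m hmreg, hα₂T _ hmreg, hψ₂, dgFormula₂_coe_torus_eq_vanDijkWeight₂_re L v (torusChart₂ L v m)]
    generalize hr : (vanDijkWeight₂ L v (torusChart₂ L v m)).re = r at hpos hΔ ⊢
    rw [hΔ]
    have ha : 0 ≤ ‖(((χ (torusChart₂ L v m)) : ℂˣ) : ℂ)‖ := norm_nonneg _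
    have hb : 0 ≤ ‖((χ (⟨w₀ * ((torusChart₂ L v m) : ↥(unitaryGroupOfForm (conjLocal L (IsCMField.complexConj L) v) (cmLocalForm L 2 v))) * w₀⁻¹, UnitaryGroup.weylConj_mem_cmTorus_two L v w₀ hw₀ (torusChart₂ L v m)⟩ : ↥(cmBorelTriple L 2 v).M) : ℂˣ) : ℂ)‖ := norm_nonneg _
    have hq : 0 ≤ ‖classOrbitalIntegral mQv φ (ConjClasses.mk ((((torusChart₂ L v m) : ↥(cmBorelTriple L 2 v).M) : ↥(unitaryGroupOfForm (conjLocal L (IsCMField.complexConj L) v) (cmLocalForm L 2 v)))))‖ := norm_nonneg _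
    have hc' : c₀.toReal ≠ 0 := hc.ne'
    have hr0 : r ≠ 0 := hpos.ne'
    have h1 : (0 : ℝ) ≤ (2 * c₀.toReal)⁻¹ * r ^ 2 := by positivity
    have h2 : (0 : ℝ) ≤ r⁻¹ := inv_nonneg.2 hpos.le
    have h3 : (0 : ℝ) ≤ ‖(((χ (torusChart₂ L v m)) : ℂˣ) : ℂ)‖ + ‖((χ (⟨w₀ * ((torusChart₂ L v m) : ↥(unitaryGroupOfForm (conjLocal L (IsCMField.complexConj L) v) (cmLocalForm L 2 v))) * w₀⁻¹, UnitaryGroup.weylConj_mem_cmTorus_two L v w₀ hw₀ (torusChart₂ L v m)⟩ : ↥(cmBorelTriple L 2 v).M) : ℂˣ) : ℂ)‖ := by positivity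
    have key : ‖(((χ (torusChart₂ L v m)) : ℂˣ) : ℂ)‖ * (r * ‖classOrbitalIntegral mQv φ (ConjClasses.mk ((((torusChart₂ L v m) : ↥(cmBorelTriple L 2 v).M) : ↥(unitaryGroupOfForm (conjLocal L (IsCMField.complexConj L) v) (cmLocalForm L 2 v)))))‖) ≤ (‖(((χ (torusChart₂ L v m)) : ℂˣ) : ℂ)‖ + ‖((χ (⟨w₀ * ((torusChart₂ L v m) : ↥(unitaryGroupOfForm (conjLocal L (IsCMField.complexConj L) v) (cmLocalForm L 2 v))) * w₀⁻¹, UnitaryGroup.weylConj_mem_cmTorus_two L v w₀ hw₀ (torusChart₂ L v m)⟩ : ↥(cmBorelTriple L 2 v).M) : ℂˣ) : ℂ)‖) * (r * ‖classOrbitalIntegral mQv φ (ConjClasses.mk ((((torusChart₂ L v m) : ↥(cmBorelTriple L 2 v).M) : ↥(unitaryGroupOfForm (conjLocal L (IsCMField.complexConj L) v) (cmLocalForm L 2 v)))))‖) :=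
      mul_le_mul_of_nonneg_right (le_add_of_nonneg_right hb) (mul_nonneg hpos.le hq)
    have hfin : ‖(((χ (torusChart₂ L v m)) : ℂˣ) : ℂ)‖ * (r * ‖classOrbitalIntegral mQv φ (ConjClasses.mk ((((torusChart₂ L v m) : ↥(cmBorelTriple L 2 v).M) : ↥(unitaryGroupOfForm (conjLocal L (IsCMField.complexConj L) v) (cmLocalForm L 2 v)))))‖) ≤
        2 * c₀.toReal * (‖classOrbitalIntegral mQv φ (ConjClasses.mk ((((torusChart₂ L v m) : ↥(cmBorelTriple L 2 v).M) : ↥(unitaryGroupOfForm (conjLocal L (IsCMField.complexConj L) v) (cmLocalForm L 2 v)))))‖ * ((2 * c₀.toReal)⁻¹ * r ^ 2) * (r⁻¹ * (‖(((χ (torusChart₂ L v m)) : ℂˣ) : ℂ)‖ + ‖((χ (⟨w₀ * ((torusChart₂ L v m) : ↥(unitaryGroupOfForm (conjLocal L (IsCMField.complexConj L) v) (cmLocalForm L 2 v))) * w₀⁻¹, UnitaryGroup.weylConj_mem_cmTorus_two L v w₀ hw₀ (torusChart₂ L v m)⟩ : ↥(cmBorelTriple L 2 v).M) : ℂˣ)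 : ℂ)‖))) := by
      calc ‖(((χ (torusChart₂ L v m)) : ℂˣ) : ℂ)‖ * (r * ‖classOrbitalIntegral mQv φ (ConjClasses.mk ((((torusChart₂ L v m) : ↥(cmBorelTriple L 2 v).M) : ↥(unitaryGroupOfForm (conjLocal L (IsCMField.complexConj L) v) (cmLocalForm L 2 v)))))‖) ≤ (‖(((χ (torusChart₂ L v m)) : ℂˣ) : ℂ)‖ + ‖((χ (⟨w₀ * ((torusChart₂ L v m) : ↥(unitaryGroupOfForm (conjLocal L (IsCMField.complexConj L) v) (cmLocalForm L 2 v))) * w₀⁻¹, UnitaryGroup.weylConj_mem_cmTorus_two L v w₀ hw₀ (torusChart₂ L v m)⟩ : ↥(cmBorelTriple L 2 v).M) : ℂˣ) : ℂ)‖) * (r * ‖classOrbitalIntegral mQv φ (ConjClasses.mk ((((torusChart₂ L v m) : ↥(cmBorelTriple L 2 v).M) : ↥(unitaryGroupOfForm (conjLocal L (IsCMField.complexConj L) v) (cmLocalForm L 2 v)))))‖) := key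
        _ = 2 * c₀.toReal * (‖classOrbitalIntegral mQv φ (ConjClasses.mk ((((torusChart₂ L v m) : ↥(cmBorelTriple L 2 v).M) : ↥(unitaryGroupOfForm (conjLocal L (IsCMField.complexConj L) v) (cmLocalForm L 2 v)))))‖ * ((2 * c₀.toReal)⁻¹ * r ^ 2) * (r⁻¹ * (‖(((χ (torusChart₂ L v m)) : ℂˣ) : ℂ)‖ + ‖((χ (⟨w₀ * ((torusChart₂ L v m) : ↥(unitaryGroupOfForm (conjLocal L (IsCMField.complexConj L) v) (cmLocalForm L 2 v))) * w₀⁻¹, UnitaryGroup.weylConj_mem_cmTorus_two L v w₀ hw₀ (torusChart₂ L v m)⟩ : ↥(cmBorelTriple L 2 v).M) : ℂˣ) : ℂ)‖))) := by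
          field_simp
    simpa only [norm_mul, Complex.norm_real, Real.norm_of_nonneg hpos.le, Real.norm_of_nonneg h1, Real.norm_of_nonneg h2,
      Real.norm_of_nonneg h3] using hfin
  -- (6) the torus-side integrand `F = χ(ι₂ m)·Δ₂·O` is integrable: measurable through `hI₁`, dominated through `hI₂`
  have hιm : Measurable (torusChart₂ L v) := (continuous_torusChart₂ L v).measurable
  have hdgm : Measurable fun m : (LocalRing L v)ˣ => dgFormula₂ L v ((((torusChart₂ L v m) : ↥(cmBorelTriple L 2 v).M) : ↥(unitaryGroupOfForm (conjLocal L (IsCMField.complexConj L) v) (cmLocalForm L 2 v)))) :=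
    (K2E3QuasiSplitTwoWeylDensity.continuous_dgFormula₂ L v).measurable.comp (continuous_subtype_val.measurable.comp hιm)
  have hFint : Integrable (fun m : (LocalRing L v)ˣ => (((χ (torusChart₂ L v m)) : ℂˣ) : ℂ) * (vanDijkWeight₂ L v (torusChart₂ L v m) * classOrbitalIntegral mQv φ (ConjClasses.mk ((((torusChart₂ L v m) : ↥(cmBorelTriple L 2 v).M) : ↥(unitaryGroupOfForm (conjLocal L (IsCMField.complexConj L) v) (cmLocalForm L 2 v))))))) μM := by
    refine Integrable.mono' ((hI₂.norm).const_mul (2 * c₀.toReal)) ?_ ?_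
    · have hpre : Measurable fun m : (LocalRing L v)ˣ => (((χ (torusChart₂ L v m)) : ℂˣ) : ℂ) * vanDijkWeight₂ L v (torusChart₂ L v m) * (((2 * c₀.toReal)⁻¹ * dgFormula₂ L v ((((torusChart₂ L v m) : ↥(cmBorelTriple L 2 v).M) : ↥(unitaryGroupOfForm (conjLocal L (IsCMField.complexConj L) v) (cmLocalForm L 2 v)))) ^ 2 : ℝ) : ℂ)⁻¹ :=
        (((hχ.comp (continuous_torusChart₂ L v)).measurable.mul
          ((continuous_vanDijkWeight₂ L v).comp (continuous_torusChart₂ L v)).measurable).mul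
          (Complex.measurable_ofReal.comp (measurable_const.mul (hdgm.pow_const 2))).inv)
      refine (hpre.aestronglyMeasurable.mul hI₁.aestronglyMeasurable).congr ?_
      filter_upwards [hreg] with m hm
      obtain ⟨hmreg, hpos⟩ := hm
      have hρ : (((2 * c₀.toReal)⁻¹ * dgFormula₂ L v ((((torusChart₂ L v m) : ↥(cmBorelTriple L 2 v).M) : ↥(unitaryGroupOfForm (conjLocal L (IsCMField.complexConj L) v) (cmLocalForm L 2 v)))) ^ 2 : ℝ) : ℂ) ≠ 0 := by
        rw [dgFormula₂_coe_torus_eq_vanDijkWeight₂_re L v (torusChart₂ L v m)]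
        exact Complex.ofReal_ne_zero.2 (mul_pos (inv_pos.2 (by positivity)) (pow_pos hpos 2)).ne'
      simp only [Pi.mul_apply]
      rw [hO' m hmreg, mul_one]
      calc (((χ (torusChart₂ L v m)) : ℂˣ) : ℂ) * vanDijkWeight₂ L v (torusChart₂ L v m) * (((2 * c₀.toReal)⁻¹ * dgFormula₂ L v ((((torusChart₂ L v m) : ↥(cmBorelTriple L 2 v).M) : ↥(unitaryGroupOfForm (conjLocal L (IsCMField.complexConj L) v) (cmLocalForm L 2 v)))) ^ 2 : ℝ) : ℂ)⁻¹ * (classOrbitalIntegral mQv φ (ConjClasses.mk ((((torusChart₂ L v m) : ↥(cmBorelTriple L 2 v).M) : ↥(unitaryGroupOfForm (conjLocal L (IsCMField.complexConj L) v) (cmLocalForm L 2 v))))) * (((2 * c₀.toReal)⁻¹ * dgFormula₂ L v ((((torusChart₂ L v m) : ↥(cmBorelTriple L 2 v).M) : ↥(unitaryGroupOfForm (conjLocal L (IsCMField.complexConj L) v) (cmLocalForm L 2 v)))) ^ 2 : ℝ) : ℂ))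
          = (((χ (torusChart₂ L v m)) : ℂˣ) : ℂ) * (vanDijkWeight₂ L v (torusChart₂ L v m) * classOrbitalIntegral mQv φ (ConjClasses.mk ((((torusChart₂ L v m) : ↥(cmBorelTriple L 2 v).M) : ↥(unitaryGroupOfForm (conjLocal L (IsCMField.complexConj L) v) (cmLocalForm L 2 v)))))) * ((((2 * c₀.toReal)⁻¹ * dgFormula₂ L v ((((torusChart₂ L v m) : ↥(cmBorelTriple L 2 v).M) : ↥(unitaryGroupOfForm (conjLocal L (IsCMField.complexConj L) v) (cmLocalForm L 2 v)))) ^ 2 : ℝ) : ℂ)⁻¹ * (((2 * c₀.toReal)⁻¹ * dgFormula₂ L v ((((torusChart₂ L v m) : ↥(cmBorelTriple L 2 v).M) : ↥(unitaryGroupOfForm (conjLocal L (IsCMField.complexConj L) v) (cmLocalForm L 2 v)))) ^ 2 : ℝ) : ℂ)) := by ring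
        _ = (((χ (torusChart₂ L v m)) : ℂˣ) : ℂ) * (vanDijkWeight₂ L v (torusChart₂ L v m) * classOrbitalIntegral mQv φ (ConjClasses.mk ((((torusChart₂ L v m) : ↥(cmBorelTriple L 2 v).M) : ↥(unitaryGroupOfForm (conjLocal L (IsCMField.complexConj L) v) (cmLocalForm L 2 v)))))) := by rw [inv_mul_cancel₀ hρ, mul_one]
    · filter_upwards [hreg] with m hm
      exact hnormS m hm.1 hm.2
  -- (7) `W`-symmetrisation: `∫ ψ(ι₂ m)·Δ₂·O dμM = 2 ∫ χ(ι₂ m)·Δ₂·O dμM`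
  have hFω : Integrable (fun m : (LocalRing L v)ˣ => (((χ (torusChart₂ L v (Units.map ((conjLocal L (IsCMField.complexConj L) v : LocalRing L v →+* LocalRing L v) : LocalRing L v →* LocalRing L v) m)⁻¹)) : ℂˣ) : ℂ) * (vanDijkWeight₂ L v (torusChart₂ L v m) * classOrbitalIntegral mQv φ (ConjClasses.mk ((((torusChart₂ L v m) : ↥(cmBorelTriple L 2 v).M) : ↥(unitaryGroupOfForm (conjLocal L (IsCMField.complexConj L) v) (cmLocalForm L 2 v))))))) μM := by
    have h := ((measurePreserving_reflect₂ L v μM).integrable_comp_emb (measurableEmbedding_reflect₂ L v)).2 hFint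
    refine h.congr (Eventually.of_forall fun m => ?_)
    simp only [Function.comp_apply]
    rw [hG m]
  have hsub : ∫ m : (LocalRing L v)ˣ, (((χ (torusChart₂ L v (Units.map ((conjLocal L (IsCMField.complexConj L) v : LocalRing L v →+* LocalRing L v) : LocalRing L v →* LocalRing L v) m)⁻¹)) : ℂˣ) : ℂ) * (vanDijkWeight₂ L v (torusChart₂ L v m) * classOrbitalIntegral mQv φ (ConjClasses.mk ((((torusChart₂ L v m) : ↥(cmBorelTriple L 2 v).M) : ↥(unitaryGroupOfForm (conjLocal L (IsCMField.complexConj L) v) (cmLocalForm L 2 v)))))) ∂μM =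
      ∫ m : (LocalRing L v)ˣ, (((χ (torusChart₂ L v m)) : ℂˣ) : ℂ) * (vanDijkWeight₂ L v (torusChart₂ L v m) * classOrbitalIntegral mQv φ (ConjClasses.mk ((((torusChart₂ L v m) : ↥(cmBorelTriple L 2 v).M) : ↥(unitaryGroupOfForm (conjLocal L (IsCMField.complexConj L) v) (cmLocalForm L 2 v)))))) ∂μM := by
    have hint := (measurePreserving_reflect₂ L v μM).integral_comp (measurableEmbedding_reflect₂ L v)
      (fun m : (LocalRing L v)ˣ => (((χ (torusChart₂ L v m)) : ℂˣ) : ℂ) * (vanDijkWeight₂ L v (torusChart₂ L v m) * classOrbitalIntegral mQv φ (ConjClasses.mk ((((torusChart₂ L v m) : ↥(cmBorelTriple L 2 v).M) : ↥(unitaryGroupOfForm (conjLocal L (IsCMField.complexConj L) v) (cmLocalForm L 2 v)))))))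
    rw [← hint]
    refine integral_congr_ae (Eventually.of_forall fun m => ?_)
    simp only
    rw [hG m]
  have hψint : ∫ m : (LocalRing L v)ˣ, ψ (torusChart₂ L v m) * (vanDijkWeight₂ L v (torusChart₂ L v m) * classOrbitalIntegral mQv φ (ConjClasses.mk ((((torusChart₂ L v m) : ↥(cmBorelTriple L 2 v).M) : ↥(unitaryGroupOfForm (conjLocal L (IsCMField.complexConj L) v) (cmLocalForm L 2 v)))))) ∂μM =
      2 * ∫ m : (LocalRing L v)ˣ, (((χ (torusChart₂ L v m)) : ℂˣ) : ℂ) * (vanDijkWeight₂ L v (torusChart₂ L v m) * classOrbitalIntegral mQv φ (ConjClasses.mk ((((torusChart₂ L v m) : ↥(cmBorelTriple L 2 v).M) : ↥(unitaryGroupOfForm (conjLocal L (IsCMField.complexConj L) v) (cmLocalForm L 2 v)))))) ∂μM := by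
    have hsum : (fun m : (LocalRing L v)ˣ => ψ (torusChart₂ L v m) * (vanDijkWeight₂ L v (torusChart₂ L v m) * classOrbitalIntegral mQv φ (ConjClasses.mk ((((torusChart₂ L v m) : ↥(cmBorelTriple L 2 v).M) : ↥(unitaryGroupOfForm (conjLocal L (IsCMField.complexConj L) v) (cmLocalForm L 2 v))))))) =
        fun m : (LocalRing L v)ˣ => (((χ (torusChart₂ L v m)) : ℂˣ) : ℂ) * (vanDijkWeight₂ L v (torusChart₂ L v m) * classOrbitalIntegral mQv φ (ConjClasses.mk ((((torusChart₂ L v m) : ↥(cmBorelTriple L 2 v).M) : ↥(unitaryGroupOfForm (conjLocal L (IsCMField.complexConj L) v) (cmLocalForm L 2 v)))))) + (((χ (torusChart₂ L v (Units.map ((conjLocal L (IsCMField.complexConj L) v : LocalRing L v →+* LocalRing L v) : LocalRing L v →* LocalRing L v) m)⁻¹)) : ℂˣ) : ℂ) * (vanDijkWeight₂ L v (torusChart₂ L v m) * classOrbitalIntegral mQv φ (ConjClasses.mk ((((torusChart₂ L v m) : ↥(cmBorelTriple L 2 v).M) : ↥(unitaryGroupOfForm (conjLocal L (IsCMField.complexConj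 L) v) (cmLocalForm L 2 v)))))) := by
      funext m
      rw [hψ, hχω m, add_mul]
    rw [hsum, integral_add hFint hFω, hsub, two_mul]
  -- (8) assembly
  rw [h1]
  have hR1 : ∫ g, φ g * (((c₀.toReal * cT⁻¹ : ℝ) : ℂ) * α g) ∂νQv = ((c₀.toReal * cT⁻¹ : ℝ) : ℂ) * ∫ g, φ' g * α g ∂νQv := by
    rw [← integral_const_mul]
    refine integral_congr_ae (Eventually.of_forall fun g => ?_)
    simp only
    by_cases hg : g ∈ hyperbolicSet₂ L v
    · rw [hφ'Ω g hg]; ring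
    · rw [hα0 g hg]; simp
  have hR2 : ∫ m : (LocalRing L v)ˣ, classOrbitalIntegral mQv φ' (ConjClasses.mk ((((torusChart₂ L v m) : ↥(cmBorelTriple L 2 v).M) : ↥(unitaryGroupOfForm (conjLocal L (IsCMField.complexConj L) v) (cmLocalForm L 2 v))))) * (((2 * c₀.toReal)⁻¹ * dgFormula₂ L v ((((torusChart₂ L v m) : ↥(cmBorelTriple L 2 v).M) : ↥(unitaryGroupOfForm (conjLocal L (IsCMField.complexConj L) v) (cmLocalForm L 2 v)))) ^ 2 : ℝ) : ℂ) * α ((((torusChart₂ L v m) : ↥(cmBorelTriple L 2 v).M) : ↥(unitaryGroupOfForm (conjLocal L (IsCMField.complexConj L) v) (cmLocalForm L 2 v)))) ∂μM =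
      (((2 * c₀.toReal)⁻¹ : ℝ) : ℂ) * ∫ m : (LocalRing L v)ˣ, ψ (torusChart₂ L v m) * (vanDijkWeight₂ L v (torusChart₂ L v m) * classOrbitalIntegral mQv φ (ConjClasses.mk ((((torusChart₂ L v m) : ↥(cmBorelTriple L 2 v).M) : ↥(unitaryGroupOfForm (conjLocal L (IsCMField.complexConj L) v) (cmLocalForm L 2 v)))))) ∂μM := by
    rw [← integral_const_mul]
    refine integral_congr_ae ?_
    filter_upwards [hreg] with m hm
    exact hρval m hm.1 hm.2
  rw [hR1, hW, hR2, hψint]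
  have hcT' : ((c₀.toReal * cT⁻¹ : ℝ) : ℂ) * ((((2 * c₀.toReal)⁻¹ : ℝ) : ℂ) * (2 * ∫ m : (LocalRing L v)ˣ, (((χ (torusChart₂ L v m)) : ℂˣ) : ℂ) * (vanDijkWeight₂ L v (torusChart₂ L v m) * classOrbitalIntegral mQv φ (ConjClasses.mk ((((torusChart₂ L v m) : ↥(cmBorelTriple L 2 v).M) : ↥(unitaryGroupOfForm (conjLocal L (IsCMField.complexConj L) v) (cmLocalForm L 2 v)))))) ∂μM)) =
      (((cT⁻¹ : ℝ)) : ℂ) * ∫ m : (LocalRing L v)ˣ, (((χ (torusChart₂ L v m)) : ℂˣ) : ℂ) * (vanDijkWeight₂ L v (torusChart₂ L v m) * classOrbitalIntegral mQv φ (ConjClasses.mk ((((torusChart₂ L v m) : ↥(cmBorelTriple L 2 v).M) : ↥(unitaryGroupOfForm (conjLocal L (IsCMField.complexConj L) v) (cmLocalForm L 2 v)))))) ∂μM := by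
    have h2c : ((c₀.toReal : ℝ) : ℂ) ≠ 0 := Complex.ofReal_ne_zero.2 hc₀r
    push_cast
    field_simp
  rw [hcT']

/-! ## §2 (ASM₂-rep) The representation-level head: `Tr i_G(χ)` is locally a function near every point -/

set_option maxHeartbeats 400000 in
/-- **(ASM₂-rep) THE CHARACTER OF `i_G(χ)` NEAR EVERY POINT OF `U(Φ₂)(L⁺_v)`** (`v` non-split, `χ` continuous, `μ` any Haar measure): for every `s : G₂` there are an
open `U ∋ s` and `Θ` integrable on `U` with `Tr i_G(χ)(f) = ∫ f·Θ dμ` for every Schwartz–Bruhat `f` supported in `U` — from §1 (`U` = the interior of a compact neighbourhood,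
`Θ` the global `L¹_loc` character).  This is the `hPS` binder of ★ `K2E3CharLocIntDifferenceOfRepresentedTwo.charLocIntNear_of_smoothTrace_eq_cmPrincipalSeries_two_sub_finite`
((res-St)₂, K2E3-p23) TOKEN FOR TOKEN, for EVERY continuous `χ` (irreducible `i_G(χ)` or not), as the dealer asked (2026-09-04T13:54:57Z).
[cite: Rogawski1990, §4.9 (4.9.4) p. 56; §12.5 p. 182] [cite: HarishChandra1999, Thm. 16.1 p. 77] [cite: vanDijk1972, Thm. p. 237] -/
theorem charLocIntNear_cmPrincipalSeries_two
    (hns : ∀ w : PlacesOver L v, IsCMField.complexConj L • w.1 = w.1)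
    [MeasurableSpace ↥(unitaryGroupOfForm (conjLocal L (IsCMField.complexConj L) v) (cmLocalForm L 2 v))] [BorelSpace ↥(unitaryGroupOfForm (conjLocal L (IsCMField.complexConj L) v) (cmLocalForm L 2 v))]
    (μ : Measure ↥(unitaryGroupOfForm (conjLocal L (IsCMField.complexConj L) v) (cmLocalForm L 2 v))) [μ.IsHaarMeasure]
    (χ : ↥(cmBorelTriple L 2 v).M →* ℂˣ) (hχ : Continuous fun t => ((χ t : ℂˣ) : ℂ)) :
    ∀ s : ↥(unitaryGroupOfForm (conjLocal L (IsCMField.complexConj L) v) (cmLocalForm L 2 v)),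
      ∃ U : Set ↥(unitaryGroupOfForm (conjLocal L (IsCMField.complexConj L) v) (cmLocalForm L 2 v)), IsOpen U ∧ s ∈ U ∧
        ∃ Θ : ↥(unitaryGroupOfForm (conjLocal L (IsCMField.complexConj L) v) (cmLocalForm L 2 v)) → ℂ, IntegrableOn Θ U μ ∧
          ∀ f : ↥(unitaryGroupOfForm (conjLocal L (IsCMField.complexConj L) v) (cmLocalForm L 2 v)) → ℂ,
            f ∈ SchwartzBruhat ↥(unitaryGroupOfForm (conjLocal L (IsCMField.complexConj L) v) (cmLocalForm L 2 v)) → tsupport f ⊆ U →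
              Representation.smoothTrace (G := ↥(unitaryGroupOfForm (conjLocal L (IsCMField.complexConj L) v) (cmLocalForm L 2 v))) (UnitaryGroup.cmPrincipalSeries L 2 v χ) μ f =
                ∫ g, f g * Θ g ∂μ := by
  intro s
  haveI : LocallyCompactSpace ↥(unitaryGroupOfForm (conjLocal L (IsCMField.complexConj L) v) (cmLocalForm L 2 v)) := locallyCompactSpace_local (IsCMField.complexConj L) 2 _ v
  obtain ⟨Θ, hΘ, htr⟩ := exists_locallyIntegrable_smoothTrace_cmPrincipalSeries_two_eq L v hns μ χ hχ
  obtain ⟨K, hK, hKs⟩ := exists_compact_mem_nhds s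
  exact ⟨interior K, isOpen_interior, mem_interior_iff_mem_nhds.2 hKs, Θ, (hΘ.integrableOn_isCompact hK).mono_set interior_subset,
    fun f hf _ => htr f hf.1 hf.2⟩

/-! ## §3 (qs2-ps) The PART «RANK» leaf, VERBATIM -/

set_option maxHeartbeats 1600000 in
set_option synthInstance.maxHeartbeats 400000 in
/-- **LEAF (qs2-ps) `sig_K2E3CharLocIntNearPrincipalSeriesQuasiSplitTwo` — PART «RANK» OF `Lines/K2_E3_EllipticInputsSigs_U12CharactersRank.lean`, STATEMENT VERBATIM**:
ROW 11 FOR THE CLASSES OF `U(Φ₂)(L⁺_v)` EQUIVALENT TO A PRINCIPAL SERIES `i_G(χ)` (`χ` a continuous character of the diagonal torus `T₂ ≅ L_wˣ`), `v` non-split, at EVERY point `s`: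
for every class `c = ⟦r⟧` with `r ≅ i_G(χ)` there are an open `U ∋ s` and `Θ ∈ L¹(U, μ)` with `χ_c(f) = ∫ f·Θ dμ` for all Schwartz–Bruhat `f` supported in `U` — §2 plus
«equivalent representations have the same character» (★ `Representation.smoothTrace_eq_of_equiv`, ★ `IrrClass.smoothTrace_mk`).  The dealer ties the socket BY NAME:
`theorem sig_K2E3CharLocIntNearPrincipalSeriesQuasiSplitTwo := K2E3CharLocIntNearPrincipalSeriesQuasiSplitTwo.charLocIntNearPrincipalSeries_quasiSplitTwo`.
[cite: vanDijk1972, Thm. p. 237] [cite: HarishChandra1970, Part V Thm. 15 p. 63] [cite: Rogawski1990, §12.1 p. 171; §4.9 (4.9.4) p. 56; §12.5 p. 182] [cite: HarishChandra1999, Thm. 16.1 p. 77] -/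
theorem charLocIntNearPrincipalSeries_quasiSplitTwo :
  ∀ (L : Type) [Field L] [NumberField L] [IsCMField L] (v : HeightOneSpectrum (𝓞 ↥(maximalRealSubfield L))),
    (∀ w : PlacesOver L v, IsCMField.complexConj L • w.1 = w.1) →
    ∀ [MeasurableSpace ↥(unitaryGroupOfForm (conjLocal L (IsCMField.complexConj L) v) (cmLocalForm L 2 v))]
      [BorelSpace ↥(unitaryGroupOfForm (conjLocal L (IsCMField.complexConj L) v) (cmLocalForm L 2 v))]
      (μ : Measure ↥(unitaryGroupOfForm (conjLocal L (IsCMField.complexConj L) v) (cmLocalForm L 2 v))) [μ.IsHaarMeasure]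
      (χ : ↥(cmBorelTriple L 2 v).M →* ℂˣ), Continuous (fun t => ((χ t : ℂˣ) : ℂ)) →
      ∀ (c : IrrClass ↥(unitaryGroupOfForm (conjLocal L (IsCMField.complexConj L) v) (cmLocalForm L 2 v)))
        (r : SmoothIrrep ↥(unitaryGroupOfForm (conjLocal L (IsCMField.complexConj L) v) (cmLocalForm L 2 v))),
        IrrClass.mk r = c → Nonempty (r.ρ.Equiv (UnitaryGroup.cmPrincipalSeries L 2 v χ)) →
      ∀ s : ↥(unitaryGroupOfForm (conjLocal L (IsCMField.complexConj L) v) (cmLocalForm L 2 v)),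
        ∃ U : Set ↥(unitaryGroupOfForm (conjLocal L (IsCMField.complexConj L) v) (cmLocalForm L 2 v)), IsOpen U ∧ s ∈ U ∧
          ∃ Θ : ↥(unitaryGroupOfForm (conjLocal L (IsCMField.complexConj L) v) (cmLocalForm L 2 v)) → ℂ, IntegrableOn Θ U μ ∧
            ∀ f : ↥(unitaryGroupOfForm (conjLocal L (IsCMField.complexConj L) v) (cmLocalForm L 2 v)) → ℂ,
              f ∈ SchwartzBruhat ↥(unitaryGroupOfForm (conjLocal L (IsCMField.complexConj L) v) (cmLocalForm L 2 v)) → tsupport f ⊆ U →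
              c.smoothTrace μ f = ∫ g, f g * Θ g ∂μ := by
  intro L _ _ _ v hns _ _ μ _ χ hχ c r hr hre s
  obtain ⟨e⟩ := hre
  obtain ⟨U, hU, hs, Θ, hΘ, htr⟩ := charLocIntNear_cmPrincipalSeries_two L v hns μ χ hχ s
  refine ⟨U, hU, hs, Θ, hΘ, fun f hf hfU => ?_⟩
  subst hr
  rw [IrrClass.smoothTrace_mk]
  have he := congrFun (Representation.smoothTrace_eq_of_equiv r.ρ μ e) f
  rw [← he]
  exact htr f hf hfU

end Summit.HodgeConjecture.HodgeConjecture.Cruxes.H413.K2E3CharLocIntNearPrincipalSeriesQuasiSplitTwo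

end
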